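import Summits.BirchSwinnertonDyer.Rank1Residual.WAll.ConjunctionGrossZagier
import Summits.BirchSwinnertonDyer.Rank1Residual.WAll.AltClosersAdditiveCells
import Summits.BirchSwinnertonDyer.Rank1Residual.WAll.TargetPrimeSlices
import HarnessLib

/-!
# Rung W-ALL of ladder BSD (D-0120) — the leaf REGISTRY with row 2 taken AT SLICE GRANULARITY
# (`p = 3` as one registered slice leaf; `p ≥ 5` from leaves + print + named residuals), composed
# with the Gross–Zagier-primary kernel (cell `bsd-wall`, lane (2), seat `bsd-wall-ty-1`)

HONEST FRAMING (cell `bsd-wall`, run/shared/lean/pub/bsd-wall/; brief `WALL-BRIEF-v1.md` sha16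
b966bf16da27706e §2): W-ALL is OPEN. This file is BOOKKEEPING: theorems only — no `def`, no
`@[conjecture]`, no named fact, nothing asserted about any curve, nothing booked, no route file
imported; every published theorem enters BY NAME as one of the tree's existing Literature facts and
stays a hypothesis. It composes landed kernels of this directory: the REGISTRY
`Rank1Residual.WAll.wAllExclusions_of_leaves` / `wAll_of_leaves` (`AltClosersGlue.lean`, seat ty-2;
Gross–Zagier-primary forms `wAll_of_leaves[_yanZhuImForm]_primaryGZ` in `AltClosersGluePrimaryGZ.lean`),
the eleven-fact kernel `wAll_of_exclusions_yanZhuImForm` (`ConjunctionYanZhu.lean`), the road of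
record of the rank binder (`ConjunctionGrossZagier.lean`, seat ty-1 g2), the PRIME × RANK SLICES of
row 2 (`TargetPrimeSlices.lean`, seat ty-1 g3) and their closers (`AltClosersAdditiveCells.lean` §3,
seat ty-2).

## What this file proves — row 2 of the registry at slice granularity

In `wAll_of_leaves` row 2 (non-CM, odd additive `p`, `r ≤ 1`) rests on leaf K1 + the CLASS-WIDE
upper half `hUp` (Euler-system half `MissingUpperBoundAt` on `N10.Locus`, ALL odd `p`, both ranks)
+ leaves K8, K9-tame, K9-wild. Sliced by prime (`wAllExclAdditive_iff_three_fiveLe`):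
* at `p = 3` — where the census residue of row 2 sits (CENSUS-EXCLUSIONS-v1.1) and where rungs W2
  (Kim-at-3), K9/KT (Kato descent at wild 3) and the wild leaf K9w live — row 2 is taken WHOLESALE as
  the slice leaf `WAllExclAdditiveAtThree` (one hypothesis; a `--closes-target` once registered);
* at `p ≥ 5` it is closed from leaf K1 (both rank halves, `Additive.additiveOrdinaryLowerHalf_iff`)
  + leaves K8, K9-tame + FOUR named print facts (Kato 2004 Thm 14.5 (3) sharp reading `hKatoS`,
  Delbourgo 1998 Prop 4 `hDel`, Kato's half-eigen divisibility via Wuthrich 2014 Cor 19 `hKatoχ`,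
  Wuthrich 2014 Thm 16 `hW16`) + the NAMED rank-`0` residual `hRes0` of
  `Rank1Residual.WAll.upperHalfRankZero_n10_of_print_of_residual` ([irreducible non-surjective image]
  ∪ [(G-ord) ∧ (reducible ∨ `p ∣ ∏ c_ℓ` ∨ every parametrisation has `p ∣ c`)]) + the rank-`1` upper
  half at `p ≥ 5` `hUp1` (OPEN class-wide) — `wallExclAdditiveFiveLe_of_leaves_of_print_of_residual`.

So `wAllExclusions_of_slicedLeaves` / `wAll_of_slicedLeaves_primaryGZ` carry, in place of (`hUp` at
all odd `p`, K9w), the slice leaf at `3` and (`hRes0`, `hUp1`, four print facts) at `p ≥ 5`: no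
hypothesis of the registry is any longer a statement over ALL odd primes except registered leaves.
COUNTS (numbers, not adjectives): `wAll_of_slicedLeaves_primaryGZ` has 17 leaf / target / slice /
residual hypotheses + 19 named print facts (incl. `sha_dvd_analyticSha`) = 36 named hypotheses
(`wAll_of_leaves_yanZhuImForm`: 16 + 12 = 28; `wAll_of_leaves_yanZhuImForm_primaryGZ`: 16 + 15 =
31). No census number moves; typed ≠ proved ≠ endorsed; nothing is proved about BSD by the recount.

References: `WAll/AltClosersGlue.lean`, `WAll/AltClosersGluePrimaryGZ.lean`, `WAll/ConjunctionYanZhu.lean`,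
`WAll/ConjunctionGrossZagier.lean`, `WAll/AltClosersAdditiveCells.lean` §3, `WAll/TargetPrimeSlices.lean`;
[cite: Darmon2004, Thm. 3.22 and §3.9] (the rank binder's road); [cite: Miller2011LMS, §1 and
Def. 1.1] (the currency).
-/

noncomputable section

open scoped Classical

open WeierstrassCurve Literature.NumberTheory.EllipticCurves
  Literature.NumberTheory.EllipticCurves.Rank1Residual
  Literature.NumberTheory.EllipticCurves.Rank1Residual.Typed
  Literature.NumberTheory.EllipticCurves.Wuthrich2014
  Literature.NumberTheory.EllipticCurves.ModularForms

set_option autoImplicit false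

namespace Summit.BirchSwinnertonDyer.Rank1Residual.WAll

open Summit.BirchSwinnertonDyer
open Summit.BirchSwinnertonDyer.BirchSwinnertonDyer.Rank1Residual (NonCMAtTwo BSDpOnClassX9)
open Additive

/-! ### §1. Row 2 at `p ≥ 5` from leaves + print + named residuals; row 2 from its slices -/

/-- **Row 2 at `p ≥ 5` (`WAllExclAdditiveFiveLe`) from leaf K1 + leaves K8, K9-tame + PRINT + the
named rank-`0` residual + the rank-`1` upper half at `p ≥ 5`** (`exclAdditiveFiveLe_of_rankSlices` ∘
`exclAdditiveRankZero_of_leaves_of_print_of_residual` / `exclAdditiveRankOne_of_leaves`; K1 split into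
its two rank halves by `Additive.additiveOrdinaryLowerHalf_iff`). No wild leaf (`ClassO6` forces
`p = 3`). CONDITIONAL; nothing closed. [folklore] -/
theorem wallExclAdditiveFiveLe_of_leaves_of_print_of_residual (hK1 : AdditiveOrdinaryLowerHalf)
    (hK8 : O5SharpGss) (hK9t : O5SharpTprime)
    (hKatoS : Kato2004.rankZero_padicValNat_sha_le_sub_localTamagawa_of_additive_potGood_of_imageContainsSL2)
    (hDel : Delbourgo1998.prop4_rankZero_pow_dvd_constantCoeff)
    (hmodP : nonempty_modularParametrizationData)
    (hKatoχ : Wuthrich2014.kato_halfEigenCharIdeal_dvd_cyclotomicPrime_of_surjective)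
    (hW16 : Wuthrich2014.thm16_halfEigenCharIdeal_dvd_cyclotomicPrime)
    (hGZK : rank_eq_analyticRank_of_analyticRank_le_one) (hmod : hasEntireLFunction_rat)
    (hRes0 : ∀ (W : WeierstrassCurve ℚ) [W.IsElliptic] [W.IsGloballyMinimal] (p : ℕ) [Fact p.Prime],
      W.analyticRank = 0 → 5 ≤ p → N10.Locus W p →
      (Irr W p ∧ ¬ Surj W p) ∨
        (¬ PotMult W p ∧ (Red W p ∨ p ∣ W.tamagawaProduct ∨
          ∀ (N : ℕ) [NeZero N] (D : ModularParametrizationData W N), (p : ℤ) ∣ D.maninConstant)) →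
      MissingUpperBoundAt W p)
    (hUp1 : ∀ (W : WeierstrassCurve ℚ) [W.IsElliptic] [W.IsGloballyMinimal] (p : ℕ) [Fact p.Prime],
      W.analyticRank = 1 → 5 ≤ p → N10.Locus W p → MissingUpperBoundAt W p) :
    WAllExclAdditiveFiveLe :=
  exclAdditiveFiveLe_of_rankSlices
    (exclAdditiveRankZero_of_leaves_of_print_of_residual (additiveOrdinaryLowerHalf_iff.mp hK1).1 hK8
      hK9t hKatoS hDel hmodP hKatoχ hW16 hGZK hmod hRes0)
    (exclAdditiveRankOne_of_leaves (additiveOrdinaryLowerHalf_iff.mp hK1).2 hUp1 hK8 hK9t hGZK)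

/-- **Row 2 from the slice leaf at `3` and the `p ≥ 5` leaf package**
(`wallExclAdditive_of_three_of_fiveLe`). CONDITIONAL; nothing closed. [folklore] -/
theorem wallExclAdditive_of_atThree_of_fiveLeLeaves (h3 : WAllExclAdditiveAtThree)
    (hK1 : AdditiveOrdinaryLowerHalf) (hK8 : O5SharpGss) (hK9t : O5SharpTprime)
    (hKatoS : Kato2004.rankZero_padicValNat_sha_le_sub_localTamagawa_of_additive_potGood_of_imageContainsSL2)
    (hDel : Delbourgo1998.prop4_rankZero_pow_dvd_constantCoeff)
    (hmodP : nonempty_modularParametrizationData)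
    (hKatoχ : Wuthrich2014.kato_halfEigenCharIdeal_dvd_cyclotomicPrime_of_surjective)
    (hW16 : Wuthrich2014.thm16_halfEigenCharIdeal_dvd_cyclotomicPrime)
    (hGZK : rank_eq_analyticRank_of_analyticRank_le_one) (hmod : hasEntireLFunction_rat)
    (hRes0 : ∀ (W : WeierstrassCurve ℚ) [W.IsElliptic] [W.IsGloballyMinimal] (p : ℕ) [Fact p.Prime],
      W.analyticRank = 0 → 5 ≤ p → N10.Locus W p →
      (Irr W p ∧ ¬ Surj W p) ∨
        (¬ PotMult W p ∧ (Red W p ∨ p ∣ W.tamagawaProduct ∨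
          ∀ (N : ℕ) [NeZero N] (D : ModularParametrizationData W N), (p : ℤ) ∣ D.maninConstant)) →
      MissingUpperBoundAt W p)
    (hUp1 : ∀ (W : WeierstrassCurve ℚ) [W.IsElliptic] [W.IsGloballyMinimal] (p : ℕ) [Fact p.Prime],
      W.analyticRank = 1 → 5 ≤ p → N10.Locus W p → MissingUpperBoundAt W p) :
    WAllExclAdditive :=
  wallExclAdditive_of_three_of_fiveLe h3
    (wallExclAdditiveFiveLe_of_leaves_of_print_of_residual hK1 hK8 hK9t hKatoS hDel hmodP hKatoχ hW16
      hGZK hmod hRes0 hUp1)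

/-! ### §2. The closed list, and W-ALL, from the registered leaves with row 2 sliced -/

/-- **THE CLOSED LIST FROM THE REGISTERED LEAVES, row 2 at slice granularity**: as
`wAllExclusions_of_leaves`, with row 2 supplied by `wallExclAdditive_of_atThree_of_fiveLeLeaves` —
the slice leaf `WAllExclAdditiveAtThree` + K1 + K8 + K9-tame + four print facts + the named
rank-`0` residual `hRes0` + the rank-`1` upper half at `p ≥ 5` `hUp1` replace (`hUp` at all odd
`p`, K9-wild). CONDITIONAL; nothing closed. [folklore] -/
theorem wAllExclusions_of_slicedLeaves (h5 : NonCMAtTwo)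
    (h3 : WAllExclAdditiveAtThree) (hK1 : AdditiveOrdinaryLowerHalf)
    (hK8 : O5SharpGss) (hK9t : O5SharpTprime)
    (hKatoS : Kato2004.rankZero_padicValNat_sha_le_sub_localTamagawa_of_additive_potGood_of_imageContainsSL2)
    (hDel : Delbourgo1998.prop4_rankZero_pow_dvd_constantCoeff)
    (hKatoχ : Wuthrich2014.kato_halfEigenCharIdeal_dvd_cyclotomicPrime_of_surjective)
    (hW16 : Wuthrich2014.thm16_halfEigenCharIdeal_dvd_cyclotomicPrime)
    (hRes0 : ∀ (W : WeierstrassCurve ℚ) [W.IsElliptic] [W.IsGloballyMinimal] (p : ℕ) [Fact p.Prime],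
      W.analyticRank = 0 → 5 ≤ p → N10.Locus W p →
      (Irr W p ∧ ¬ Surj W p) ∨
        (¬ PotMult W p ∧ (Red W p ∨ p ∣ W.tamagawaProduct ∨
          ∀ (N : ℕ) [NeZero N] (D : ModularParametrizationData W N), (p : ℤ) ∣ D.maninConstant)) →
      MissingUpperBoundAt W p)
    (hUp1 : ∀ (W : WeierstrassCurve ℚ) [W.IsElliptic] [W.IsGloballyMinimal] (p : ℕ) [Fact p.Prime],
      W.analyticRank = 1 → 5 ≤ p → N10.Locus W p → MissingUpperBoundAt W p)
    (hK2a : X11b.MultiplicativeRankOne) (hK2b : X11b.MultiplicativeRankOneAtThree)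
    (hK5 : Eisenstein.EisensteinPrimes) (hK3 : Supersingular.SignedSupersingular)
    (hK6 : BSDpOnClassX9) (hX10b : X10.BSDpOnClassX10b) (hX11a : X11a.Target)
    (hIn : X12.CMInertBad) (hF2 : WAllCornerFTwo) (hFr : WAllCornerFRamified)
    (hW : sha_dvd_analyticSha) (hmod : hasEntireLFunction_rat)
    (hmodP : nonempty_modularParametrizationData)
    (hGZK : rank_eq_analyticRank_of_analyticRank_le_one)
    (hLLT : LiLiuTian2024.thm11_bsdp_of_cm_rank_one) : WAllExclusions := by
  obtain ⟨hX1, hX2, hX2c⟩ := wallEisenstein_of_eisensteinPrimes hK5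
  exact ⟨h5,
    wallExclAdditive_of_atThree_of_fiveLeLeaves h3 hK1 hK8 hK9t hKatoS hDel hmodP hKatoχ hW16 hGZK hmod
      hRes0 hUp1,
    wAllExclMultRankOne_iff.mpr ⟨wallExclX11b_of_rungK2 hK2a hK2b, hX2c⟩, hX1, hX2,
    wallCornerX6r0_of_signedSupersingular hK3 hW hGZK hmod,
    wallCornerX7_of_signedSupersingular hK3 hW hGZK hmod,
    wallCornerX8_of_signedSupersingular hK3 hW hGZK hmod, wallCornerX9_of_bsdpOnClassX9 hmod hGZK hK6,
    wallCornerX10b_of_bsdpOnClassX10b hX10b, wallCornerX11a_of_x11aTarget hX11a,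
    wallCornerF_of_leaves hLLT hGZK hIn hF2 hFr⟩

/-- **W-ALL FROM THE REGISTERED LEAVES, row 2 at slice granularity, Gross–Zagier side primary**
(`wAll_of_exclusions_yanZhuImForm ∘ wAllExclusions_of_slicedLeaves`, with `hmod` derived from
`hmodP` and the rank binder fed from `hmodP`, `hWa`, `hMM`, `hGZ`, `hKo` by
`rank_eq_analyticRank_of_analyticRank_le_one_of_nonempty_modularParametrizationData`). Hypotheses:
leaves K4, K1, K8, K9t, K2a, K2b, K5, K3, K6, the slice leaf `WAllExclAdditiveAtThree`, typed
targets X10b / X11a, the CM leaf K8-CM, `WAllCornerFTwo`, `WAllCornerFRamified`, the named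
residuals `hRes0` / `hUp1`, `sha_dvd_analyticSha`, and EIGHTEEN further named print facts (Kato
2004 Thm 14.5 (3) · Delbourgo 1998 Prop 4 · Wuthrich 2014 Cor 19 reading · Wuthrich 2014 Thm 16 ·
Skinner 2016 Thm C · JSW17 Thm 1.2.1 · CGS25 Thm D · Greenberg–Vatsal 2000 Thm 1.3 · Greenberg
1999 · BCDT 2001 Thm A (6) · Waldspurger 1985 Thm 5 · Murty–Murty 1991 · Gross–Zagier 1986 V.(2.1)
· Kolyvagin 1990 Thm A · Rubin 1991 / Burungale–Flach 2024 · Kobayashi 2013 Cor 1.4 · Yan–Zhu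
2026 (Im) · Li–Liu–Tian 2024 Thm 1.1). CONDITIONAL; nothing closed. [cite: Darmon2004, Thm. 3.22 and §3.9] -/
theorem wAll_of_slicedLeaves_primaryGZ (h5 : NonCMAtTwo)
    (h3 : WAllExclAdditiveAtThree) (hK1 : AdditiveOrdinaryLowerHalf)
    (hK8 : O5SharpGss) (hK9t : O5SharpTprime)
    (hRes0 : ∀ (W : WeierstrassCurve ℚ) [W.IsElliptic] [W.IsGloballyMinimal] (p : ℕ) [Fact p.Prime],
      W.analyticRank = 0 → 5 ≤ p → N10.Locus W p →
      (Irr W p ∧ ¬ Surj W p) ∨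
        (¬ PotMult W p ∧ (Red W p ∨ p ∣ W.tamagawaProduct ∨
          ∀ (N : ℕ) [NeZero N] (D : ModularParametrizationData W N), (p : ℤ) ∣ D.maninConstant)) →
      MissingUpperBoundAt W p)
    (hUp1 : ∀ (W : WeierstrassCurve ℚ) [W.IsElliptic] [W.IsGloballyMinimal] (p : ℕ) [Fact p.Prime],
      W.analyticRank = 1 → 5 ≤ p → N10.Locus W p → MissingUpperBoundAt W p)
    (hK2a : X11b.MultiplicativeRankOne) (hK2b : X11b.MultiplicativeRankOneAtThree)
    (hK5 : Eisenstein.EisensteinPrimes) (hK3 : Supersingular.SignedSupersingular)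
    (hK6 : BSDpOnClassX9) (hX10b : X10.BSDpOnClassX10b) (hX11a : X11a.Target)
    (hIn : X12.CMInertBad) (hF2 : WAllCornerFTwo) (hFr : WAllCornerFRamified)
    (hW : sha_dvd_analyticSha)
    -- named print facts: the four of the rank-0 `p ≥ 5` upper half, then the kernel's fourteen
    (hKatoS : Kato2004.rankZero_padicValNat_sha_le_sub_localTamagawa_of_additive_potGood_of_imageContainsSL2)
    (hDel : Delbourgo1998.prop4_rankZero_pow_dvd_constantCoeff)
    (hKatoχ : Wuthrich2014.kato_halfEigenCharIdeal_dvd_cyclotomicPrime_of_surjective)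
    (hW16 : Wuthrich2014.thm16_halfEigenCharIdeal_dvd_cyclotomicPrime)
    (hSk : Skinner2016.thmC_padicValRat_bsd_rank_zero)
    (hJSW : JetchevSkinnerWan2017.thm121_padicValRat_bsd_rank_one)
    (hCGS : CastellaGrossiSkinner2025.thmD_padicValRat_bsd_rank_le_one)
    (hGV : GreenbergVatsal2000.thm13_charIdeal_eq_of_gvPar) (hGr : greenberg_charValue_rankZero)
    (hmodP : nonempty_modularParametrizationData)
    (hWa : waldspurger_exists_heegnerField_twist_ne_zero)
    (hMM : murtyMurty_exists_heegnerField_twist_simpleZero)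
    (hGZ : ∀ (N : ℕ) [NeZero N] (W : WeierstrassCurve ℚ) (K : Type) [Field K] [NumberField K],
      gross_zagier N W K)
    (hKo : ∀ (N : ℕ) [NeZero N] (W : WeierstrassCurve ℚ) (K : Type) [Field K] [NumberField K],
      kolyvagin N W K)
    (hCM : bsdTriple_of_hasCM_of_L_one_ne_zero) (hKob : Kobayashi2013.cor14_bsdp_of_cm_rank_one)
    (hYZ : YanZhu2026.thm415_padicValRat_bsd_rank_le_one_of_bigIm)
    (hLLT : LiLiuTian2024.thm11_bsdp_of_cm_rank_one) : WAll :=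
  have hmod : hasEntireLFunction_rat :=
    X2.ClassClosureEntireFree.hasEntireLFunction_rat_of_nonempty_modularParametrizationData hmodP
  have hGZK : rank_eq_analyticRank_of_analyticRank_le_one :=
    rank_eq_analyticRank_of_analyticRank_le_one_of_nonempty_modularParametrizationData hmodP hWa hMM
      hGZ hKo
  wAll_of_exclusions_yanZhuImForm
    (wAllExclusions_of_slicedLeaves h5 h3 hK1 hK8 hK9t hKatoS hDel hKatoχ hW16 hRes0 hUp1 hK2a hK2b hK5
      hK3 hK6 hX10b hX11a hIn hF2 hFr hW hmod hmodP hGZK hLLT)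
    hSk hJSW hCGS hGV hGr hmodP hGZK hCM hKob hYZ hLLT

/-- **Its leading-term reading with ONE sign binder** (`wAllFormula_of_wAll_oneSign`): the
hypotheses of `wAll_of_slicedLeaves_primaryGZ` and `hL0 : re_entireLFunction_one_nonneg` give
`WAllFormula` (the full BSD formula for every `E/ℚ` of analytic rank `≤ 1`). CONDITIONAL; nothing
closed. [cite: GrossZagier1986, Thm. V.(2.1) (p. 311) and V.§2 (pp. 312–313)] -/
theorem wAllFormula_of_slicedLeaves_oneSign (h5 : NonCMAtTwo)
    (h3 : WAllExclAdditiveAtThree) (hK1 : AdditiveOrdinaryLowerHalf)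
    (hK8 : O5SharpGss) (hK9t : O5SharpTprime)
    (hRes0 : ∀ (W : WeierstrassCurve ℚ) [W.IsElliptic] [W.IsGloballyMinimal] (p : ℕ) [Fact p.Prime],
      W.analyticRank = 0 → 5 ≤ p → N10.Locus W p →
      (Irr W p ∧ ¬ Surj W p) ∨
        (¬ PotMult W p ∧ (Red W p ∨ p ∣ W.tamagawaProduct ∨
          ∀ (N : ℕ) [NeZero N] (D : ModularParametrizationData W N), (p : ℤ) ∣ D.maninConstant)) →
      MissingUpperBoundAt W p)
    (hUp1 : ∀ (W : WeierstrassCurve ℚ) [W.IsElliptic] [W.IsGloballyMinimal] (p : ℕ) [Fact p.Prime],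
      W.analyticRank = 1 → 5 ≤ p → N10.Locus W p → MissingUpperBoundAt W p)
    (hK2a : X11b.MultiplicativeRankOne) (hK2b : X11b.MultiplicativeRankOneAtThree)
    (hK5 : Eisenstein.EisensteinPrimes) (hK3 : Supersingular.SignedSupersingular)
    (hK6 : BSDpOnClassX9) (hX10b : X10.BSDpOnClassX10b) (hX11a : X11a.Target)
    (hIn : X12.CMInertBad) (hF2 : WAllCornerFTwo) (hFr : WAllCornerFRamified)
    (hW : sha_dvd_analyticSha)
    (hKatoS : Kato2004.rankZero_padicValNat_sha_le_sub_localTamagawa_of_additive_potGood_of_imageContainsSL2)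
    (hDel : Delbourgo1998.prop4_rankZero_pow_dvd_constantCoeff)
    (hKatoχ : Wuthrich2014.kato_halfEigenCharIdeal_dvd_cyclotomicPrime_of_surjective)
    (hW16 : Wuthrich2014.thm16_halfEigenCharIdeal_dvd_cyclotomicPrime)
    (hSk : Skinner2016.thmC_padicValRat_bsd_rank_zero)
    (hJSW : JetchevSkinnerWan2017.thm121_padicValRat_bsd_rank_one)
    (hCGS : CastellaGrossiSkinner2025.thmD_padicValRat_bsd_rank_le_one)
    (hGV : GreenbergVatsal2000.thm13_charIdeal_eq_of_gvPar) (hGr : greenberg_charValue_rankZero)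
    (hmodP : nonempty_modularParametrizationData)
    (hWa : waldspurger_exists_heegnerField_twist_ne_zero)
    (hMM : murtyMurty_exists_heegnerField_twist_simpleZero)
    (hGZ : ∀ (N : ℕ) [NeZero N] (W : WeierstrassCurve ℚ) (K : Type) [Field K] [NumberField K],
      gross_zagier N W K)
    (hKo : ∀ (N : ℕ) [NeZero N] (W : WeierstrassCurve ℚ) (K : Type) [Field K] [NumberField K],
      kolyvagin N W K)
    (hCM : bsdTriple_of_hasCM_of_L_one_ne_zero) (hKob : Kobayashi2013.cor14_bsdp_of_cm_rank_one)
    (hYZ : YanZhu2026.thm415_padicValRat_bsd_rank_le_one_of_bigIm)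
    (hLLT : LiLiuTian2024.thm11_bsdp_of_cm_rank_one)
    (hL0 : re_entireLFunction_one_nonneg) : WAllFormula :=
  wAllFormula_of_wAll_oneSign hmodP hL0 hWa hGZ
    (wAll_of_slicedLeaves_primaryGZ h5 h3 hK1 hK8 hK9t hRes0 hUp1 hK2a hK2b hK5 hK3 hK6 hX10b hX11a hIn
      hF2 hFr hW hKatoS hDel hKatoχ hW16 hSk hJSW hCGS hGV hGr hmodP hWa hMM hGZ hKo hCM hKob hYZ hLLT)

end Summit.BirchSwinnertonDyer.Rank1Residual.WAll

end
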